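import Literature.Probability.RandomPlanarGeometry.SAWPulledLargeForceKestenEquation
import Mathlib.Analysis.SpecificLimits.Basic
import HarnessLib

/-!
# The pulled self-avoiding walk on `ℤ²` at large force: the expansion of `e^{λ_B(y)}` in powers of `1/y`
# EXISTS TO ALL ORDERS and has INTEGER coefficients

Topic `Literature/Probability/RandomPlanarGeometry` (uses `SAWPulledLargeForceKestenEquation.lean`: the expansion variable
`u(y) = y e^{-λ_B(y)} = Zd.largeForceU`, its window/positivity (`Zd.largeForceU_mem_Icc`, `largeForceU_lt_one`), the cost
coefficients `N_{c,n} = Zd.costCoeff c n` (number of irreducible bridges of length `n` and cost `n − span`), `P_0(u) = u`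
(`Zd.costCoeff_zero`), `N_{c,n} ≤ c_n` (`Zd.costCoeff_le_count`), and ★ Kesten's equation in the expansion variables
`Σ_c y^{-c} P_c(u(y)) = 1` for `y ≥ 18` (`Zd.hasSum_costPoly_largeForce`); `SAWPulledBridgeFreeEnergy.lean`: `c_N ≤ c_1^N`).

Printed status. E. J. Janse van Rensburg, S. G. Whittington, J. Phys. A 46 (2013) 435003, §3.2 Theorem 8 / Corollary 2 (arXiv v4
p. 11): the FIRST order `λ(y) = log y + O(1)`; N. R. Beaton, J. Phys. A 48 (2015) 16FT03, Theorem 1 (`λ = max(log μ, λ_B)`) and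
Lemma 2 (Kesten's equation `I(e^{-λ}, y) = 1`). The lane («pcv-sawmu») certified the coefficients `2, −2, 6, −20, 74, −284, 1100,
−4188, 15148, −48674, 111428` order by order by finite certificates (tree files `SAWPulledLargeForce{Third,Fourth,…}Order.lean`); the
EXISTENCE of the expansion to all orders, and the integrality of all its coefficients, is the theorem of this file — we know of no
printed source.

## The argument

With `t = 1/y` and `u = u(y) ∈ (0, 1)`, Kesten's equation reads `G(u, t) := Σ_{c ≥ 0} t^c P_c(u) = 1` with `P_c(u) = Σ_n N_{c,n} uⁿ ∈ ℕ[u]`,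
`deg P_c ≤ 2c + 1`, `P_0(u) = u`, `Σ_n N_{c,n} ≤ B ρ^c` (`B = 2c_1`, `ρ = 2c_1²`). Hence `u = 1 − Σ_{c ≥ 1} t^c P_c(u)`, a contraction
in the `t`-adic sense: the integer polynomials `A_0 = 1`, `A_{K+1} = 1 − Σ_{c=1}^{K+1} X^c · P_c(A_K)` satisfy
`|u(1/t) − A_K(t)| ≤ C_K t^{K+1}` on some `(0, t_K]` (induction on `K`: the `c`-th term is `t^c`-small, `P_c` is Lipschitz on `[−2, 2]`,
and the tail `Σ_{c > K+1} t^c P_c(u) ≤ 2B(ρt)^{K+2}` is geometric) — `CostSeries.expansion`, proved for ANY such system `(N, u)`.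
Finally `e^{λ_B(y)} = y/u(y)` and `1/A_K = Σ_{j ≤ K} (1 − A_K)^j + (1 − A_K)^{K+1}/A_K` with `1 − A_K(t) = O(t)` give the integer
polynomials `E_K = Σ_{j ≤ K} (1 − A_K)^j` with `e^{λ_B(y)} = y · E_K(1/y) + O(y^{-K})`.

## Contents (namespace `Literature.Probability.RandomPlanarGeometry.SAW.Zd`; all PROVED, standard axioms; no data, no certificates)

* `CostSeries.P / Pz / A / ev / L` (generic data `N : ℕ → ℕ → ℕ`): the polynomials `P_c`, their integer-polynomial form, the
  approximants `A_K ∈ ℤ[X]`, real evaluation, Lipschitz constants; `CostSeries.ev_A_succ`, `abs_pow_sub_pow_le`, `abs_P_sub_P_le`,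
  `tsum_tail_le`, ★ **`CostSeries.expansion`** (the all-orders expansion of the solution of `u = 1 − Σ_{c≥1} t^c P_c(u)`).
* pulled walk: `sum_costCoeff_le` (`Σ_n N_{c,n} ≤ 2c_1 (2c_1²)^c`), `P_costCoeff_zero`, `hasSum_costPoly_inv` (Kesten's equation in `t`),
  ★ **`largeForceU_expansion`** (`|u(y) − A_K(1/y)| ≤ C / y^{K+1}` for large `y`), `half_le_largeForceU`, `one_sub_largeForceU_le`,
  the integer polynomials **`largeForcePoly K = E_K`** with `ev_largeForcePoly`, and
  ★★ **`exp_pulledBridgeFreeEnergy_expansion`**: `∀ K, ∃ C y₁, ∀ y ≥ y₁, |e^{λ_B(y)} − y · E_K(1/y)| ≤ C / y^K`;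
  `largeForcePoly_coeff_zero` (`E_K(0) = 1`).
* UNIQUENESS and THE coefficient sequence: `coeff_eq_zero_of_abs_le` (private: a real polynomial which is `O(t^m)` at `0⁺` has no
  coefficient below `m`), **`largeForcePoly_coeff_eq`** (`[X^k] E_K = [X^k] E_{K'}` for `k ≤ K ≤ K'`), the integers
  **`largeForceCoeff k := [X^k] E_k = c_k`** with `largeForcePoly_coeff`, `largeForceCoeff_zero` (`c_0 = 1`), and
  ★★ **`exp_pulledBridgeFreeEnergy_expansion_coeff`**: `∀ K, ∃ C y₁, ∀ y ≥ y₁, |e^{λ_B(y)} − y · Σ_{k ≤ K} c_k y^{-k}| ≤ C / y^K` —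
  ONE integer sequence `(c_k)` with `e^{λ_B(y)} ~ Σ_k c_k y^{1−k}` to every order.

The tree's certified windows identify `c_0, …, c_5 = 1, 2, −2, 6, −20, 74` (and the lane's order files the next ones); that
identification is NOT restated here. Provenance: lane «pcv-sawmu», a-p3 g15 (2026-08-24).
-/

noncomputable section

open Finset Filter Topology
open scoped BigOperators

namespace Literature.Probability.RandomPlanarGeometry.SAW.Zd

/-! ### A generic lemma: implicit equations `u = 1 − Σ_{c ≥ 1} t^c P_c(u)` with `P_c ∈ ℕ[u]` -/

namespace CostSeries

variable (N : ℕ → ℕ → ℕ)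

/-- `P_c(x) = Σ_{n < 2c+2} N_{c,n} xⁿ`. [folklore] -/
def P (c : ℕ) (x : ℝ) : ℝ := ∑ n ∈ Finset.range (2 * c + 2), (N c n : ℝ) * x ^ n

/-- `P_c` as an integer polynomial. [folklore] -/
def Pz (c : ℕ) : Polynomial ℤ := ∑ n ∈ Finset.range (2 * c + 2), Polynomial.C (N c n : ℤ) * Polynomial.X ^ n

/-- The approximants: `A_0 = 1`, `A_{K+1} = 1 − Σ_{c=1}^{K+1} X^c · P_c(A_K)` (integer polynomials). [folklore] -/
def A : ℕ → Polynomial ℤ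
  | 0 => 1
  | K + 1 => 1 - ∑ j ∈ Finset.range (K + 1), Polynomial.X ^ (j + 1) * (Pz N (j + 1)).comp (A K)

/-- Real evaluation of an integer polynomial. [folklore] -/
def ev (p : Polynomial ℤ) (t : ℝ) : ℝ := Polynomial.aeval t p

/-- `ev (Pz c) = P_c`. [folklore] -/
private theorem ev_Pz (c : ℕ) (x : ℝ) : ev (Pz N c) x = P N c x := by
  simp [ev, Pz, P, map_sum]

/-- `A_0 = 1`. [folklore] -/
private theorem ev_A_zero (t : ℝ) : ev (A N 0) t = 1 := by simp [ev, A]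

/-- Evaluation of the recursion `A_{K+1} = 1 − Σ_{c=1}^{K+1} X^c P_c(A_K)`. [folklore] -/
private theorem ev_A_succ (K : ℕ) (t : ℝ) :
    ev (A N (K + 1)) t = 1 - ∑ j ∈ Finset.range (K + 1), t ^ (j + 1) * P N (j + 1) (ev (A N K) t) := by
  have h : ∀ j, ev (Polynomial.X ^ (j + 1) * (Pz N (j + 1)).comp (A N K)) t = t ^ (j + 1) * P N (j + 1) (ev (A N K) t) := by
    intro j
    rw [← ev_Pz N (j + 1)]
    simp [ev, Polynomial.aeval_comp]
  show ev (1 - ∑ j ∈ Finset.range (K + 1), Polynomial.X ^ (j + 1) * (Pz N (j + 1)).comp (A N K)) t = _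
  simp only [ev, map_sub, map_one, map_sum]
  congr 1
  exact Finset.sum_congr rfl fun j _ => h j

/-- `P_c` is bounded by `Σ_n N_{c,n}` on `[0,1]`. [folklore] -/
private theorem P_le_sum {c : ℕ} {x : ℝ} (h0 : 0 ≤ x) (h1 : x ≤ 1) :
    P N c x ≤ ∑ n ∈ Finset.range (2 * c + 2), (N c n : ℝ) := by
  unfold P
  refine Finset.sum_le_sum fun n _ => ?_
  have : x ^ n ≤ 1 := pow_le_one₀ h0 h1
  have hN : (0 : ℝ) ≤ N c n := by positivity
  nlinarith

/-- `P_c ≥ 0` on `[0, ∞)`. [folklore] -/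
private theorem P_nonneg {c : ℕ} {x : ℝ} (h0 : 0 ≤ x) : 0 ≤ P N c x := by
  unfold P
  exact Finset.sum_nonneg fun n _ => by positivity

/-- Lipschitz constant of `P_c` on `[-2, 2]`: `L_c = Σ_n N_{c,n} · n · 2^{n-1}`. [folklore] -/
def L (c : ℕ) : ℝ := ∑ n ∈ Finset.range (2 * c + 2), (N c n : ℝ) * (n * 2 ^ (n - 1))

/-- `|xⁿ − x'ⁿ| ≤ n Mⁿ⁻¹ |x − x'|` for `|x|, |x'| ≤ M`. [folklore] -/
private theorem abs_pow_sub_pow_le {x x' M : ℝ} (hx : |x| ≤ M) (hx' : |x'| ≤ M) (n : ℕ) :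
    |x ^ n - x' ^ n| ≤ n * M ^ (n - 1) * |x - x'| := by
  have hM : 0 ≤ M := (abs_nonneg x).trans hx
  induction n with
  | zero => simp
  | succ n ih =>
    have hsplit : x ^ (n + 1) - x' ^ (n + 1) = x * (x ^ n - x' ^ n) + (x - x') * x' ^ n := by ring
    rw [hsplit]
    calc |x * (x ^ n - x' ^ n) + (x - x') * x' ^ n|
        ≤ |x| * |x ^ n - x' ^ n| + |x - x'| * |x'| ^ n := by
          refine (abs_add_le _ _).trans ?_
          rw [abs_mul, abs_mul, abs_pow]
      _ ≤ M * (n * M ^ (n - 1) * |x - x'|) + |x - x'| * M ^ n := by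
          gcongr
      _ = (n * (M * M ^ (n - 1)) + M ^ n) * |x - x'| := by ring
      _ ≤ ((n + 1 : ℕ) * M ^ n) * |x - x'| := by
          refine mul_le_mul_of_nonneg_right ?_ (abs_nonneg _)
          rcases Nat.eq_zero_or_pos n with rfl | hn
          · simp
          · have : M * M ^ (n - 1) = M ^ n := by rw [← pow_succ', Nat.sub_add_cancel hn]
            rw [this]; push_cast; nlinarith [pow_nonneg hM n]
      _ = ((n + 1 : ℕ) : ℝ) * M ^ (n + 1 - 1) * |x - x'| := by simp

/-- `P_c` is `L_c`-Lipschitz on `[-2, 2]`. [folklore] -/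
private theorem abs_P_sub_P_le {c : ℕ} {x x' : ℝ} (hx : |x| ≤ 2) (hx' : |x'| ≤ 2) :
    |P N c x - P N c x'| ≤ L N c * |x - x'| := by
  unfold P L
  rw [← Finset.sum_sub_distrib, Finset.sum_mul]
  refine (Finset.abs_sum_le_sum_abs _ _).trans (Finset.sum_le_sum fun n _ => ?_)
  rw [← mul_sub, abs_mul, Nat.abs_cast, mul_assoc]
  refine mul_le_mul_of_nonneg_left ?_ (Nat.cast_nonneg _)
  exact abs_pow_sub_pow_le hx hx' n

/-- `L_c ≥ 0`. [folklore] -/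
private theorem L_nonneg (c : ℕ) : 0 ≤ L N c := by
  unfold L; exact Finset.sum_nonneg fun n _ => by positivity

/-- Tail bound: if `P_c(u) ≤ B ρ^c` termwise (via `0 ≤ u ≤ 1`) and `ρ t ≤ 1/2`, then `Σ_{j} t^{j+m} P_{j+m}(u) ≤ 2 B (ρ t)^m`. [folklore] -/
private theorem tsum_tail_le {B ρ t x : ℝ} (hB : 0 ≤ B) (hρ : 0 < ρ) (ht : 0 < t) (hρt : ρ * t ≤ 1 / 2)
    (hN : ∀ c, (∑ n ∈ Finset.range (2 * c + 2), (N c n : ℝ)) ≤ B * ρ ^ c) (hx0 : 0 ≤ x) (hx1 : x ≤ 1)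
    (hs : Summable fun c => t ^ c * P N c x) (m : ℕ) :
    ∑' j, t ^ (j + m) * P N (j + m) x ≤ 2 * B * (ρ * t) ^ m := by
  have hr0 : 0 ≤ ρ * t := by positivity
  have hr1 : ρ * t < 1 := by linarith
  have hsm : Summable fun j => t ^ (j + m) * P N (j + m) x :=
    (summable_nat_add_iff (f := fun c => t ^ c * P N c x) m).2 hs
  have hgeo : Summable fun j : ℕ => B * (ρ * t) ^ m * (ρ * t) ^ j :=
    (summable_geometric_of_lt_one hr0 hr1).mul_left _
  have hle : ∀ j, t ^ (j + m) * P N (j + m) x ≤ B * (ρ * t) ^ m * (ρ * t) ^ j := by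
    intro j
    have h1 : P N (j + m) x ≤ B * ρ ^ (j + m) := (P_le_sum N hx0 hx1).trans (hN _)
    have h2 : 0 ≤ t ^ (j + m) := by positivity
    calc t ^ (j + m) * P N (j + m) x ≤ t ^ (j + m) * (B * ρ ^ (j + m)) := mul_le_mul_of_nonneg_left h1 h2
      _ = B * (ρ * t) ^ m * (ρ * t) ^ j := by rw [mul_pow, mul_pow]; ring
  calc ∑' j, t ^ (j + m) * P N (j + m) x ≤ ∑' j, B * (ρ * t) ^ m * (ρ * t) ^ j := hsm.tsum_le_tsum hle hgeo
    _ = B * (ρ * t) ^ m * (1 - ρ * t)⁻¹ := by rw [tsum_mul_left, tsum_geometric_of_lt_one hr0 hr1]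
    _ ≤ B * (ρ * t) ^ m * 2 := by
        refine mul_le_mul_of_nonneg_left ?_ (by positivity)
        rw [inv_le_comm₀ (by linarith) (by norm_num)]; linarith
    _ = 2 * B * (ρ * t) ^ m := by ring

/-- **All-orders expansion of the solution of `u = 1 − Σ_{c≥1} t^c P_c(u)`**: if `P_c ∈ ℕ[u]` with `deg P_c ≤ 2c + 1`,
`Σ_n N_{c,n} ≤ B ρ^c`, `P_0(u) = u`, and `u : (0, t₀] → [0, 1]` satisfies `Σ_c t^c P_c(u(t)) = 1`, then for every `K` the integer
polynomial `A_K` approximates `u` to order `t^{K+1}`: `|u(t) − A_K(t)| ≤ C_K t^{K+1}` on some `(0, t_K]` (elementary; the method of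
undetermined coefficients with a geometric tail bound). [cite: JansevanRensburgWhittington2013, §3.2 Theorem 8 (arXiv v4 p. 11)] -/
theorem expansion {B ρ t₀ : ℝ} {u : ℝ → ℝ} (hB : 0 ≤ B) (hρ : 0 < ρ) (ht₀ : 0 < t₀)
    (hN : ∀ c, (∑ n ∈ Finset.range (2 * c + 2), (N c n : ℝ)) ≤ B * ρ ^ c) (hP0 : ∀ x, P N 0 x = x)
    (hmem : ∀ t ∈ Set.Ioc 0 t₀, u t ∈ Set.Icc (0 : ℝ) 1)
    (heq : ∀ t ∈ Set.Ioc 0 t₀, HasSum (fun c => t ^ c * P N c (u t)) 1) (K : ℕ) :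
    ∃ C t₁ : ℝ, 0 ≤ C ∧ 0 < t₁ ∧ t₁ ≤ t₀ ∧ ∀ t ∈ Set.Ioc 0 t₁, |u t - ev (A N K) t| ≤ C * t ^ (K + 1) := by
  -- the tail identity `Σ' j, t^{j+1} P_{j+1}(u t) = 1 - u t`
  have htail : ∀ t ∈ Set.Ioc 0 t₀, ∑' j, t ^ (j + 1) * P N (j + 1) (u t) = 1 - u t := by
    intro t ht
    have h := (heq t ht).tsum_eq
    rw [(heq t ht).summable.tsum_eq_zero_add] at h
    simp only [pow_zero, one_mul, hP0] at h
    linarith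
  induction K with
  | zero =>
    refine ⟨2 * B * ρ, min t₀ (1 / (2 * ρ)), by positivity, lt_min ht₀ (by positivity), min_le_left _ _, ?_⟩
    intro t ht
    have ht0 : 0 < t := ht.1
    have htt₀ : t ≤ t₀ := ht.2.trans (min_le_left _ _)
    have hρt : ρ * t ≤ 1 / 2 := by
      have : t ≤ 1 / (2 * ρ) := ht.2.trans (min_le_right _ _)
      rw [le_div_iff₀ (by positivity)] at this; linarith
    obtain ⟨hu0, hu1⟩ := hmem t ⟨ht0, htt₀⟩
    rw [ev_A_zero, abs_sub_comm, abs_of_nonneg (by linarith), ← htail t ⟨ht0, htt₀⟩]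
    have := tsum_tail_le N hB hρ ht0 hρt hN hu0 hu1 (heq t ⟨ht0, htt₀⟩).summable 1
    simpa [pow_one, mul_comm, mul_left_comm, mul_assoc] using this
  | succ K ih =>
    obtain ⟨C, t₁, hC, ht₁, ht₁₀, hIH⟩ := ih
    set Lsum : ℝ := ∑ j ∈ Finset.range (K + 1), L N (j + 1) with hLsum
    have hLsum0 : 0 ≤ Lsum := Finset.sum_nonneg fun j _ => L_nonneg N (j + 1)
    refine ⟨C * Lsum + 2 * B * ρ ^ (K + 2), min t₁ (min (1 / (2 * ρ)) (min 1 (1 / (C + 1)))), by positivity,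
      lt_min ht₁ (lt_min (by positivity) (lt_min one_pos (by positivity))), (min_le_left _ _).trans ht₁₀, ?_⟩
    intro t ht
    have ht0 : 0 < t := ht.1
    have htt₁ : t ≤ t₁ := ht.2.trans (min_le_left _ _)
    have htt₀ : t ≤ t₀ := htt₁.trans ht₁₀
    have hρt : ρ * t ≤ 1 / 2 := by
      have : t ≤ 1 / (2 * ρ) := ht.2.trans ((min_le_right _ _).trans (min_le_left _ _))
      rw [le_div_iff₀ (by positivity)] at this; linarith
    have ht1 : t ≤ 1 := ht.2.trans ((min_le_right _ _).trans ((min_le_right _ _).trans (min_le_left _ _)))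
    have htC : t ≤ 1 / (C + 1) := ht.2.trans ((min_le_right _ _).trans ((min_le_right _ _).trans (min_le_right _ _)))
    obtain ⟨hu0, hu1⟩ := hmem t ⟨ht0, htt₀⟩
    set a := ev (A N K) t with ha
    -- the previous approximant is within 1 of u, hence |a| ≤ 2
    have hK := hIH t ⟨ht0, htt₁⟩
    have hCt : C * t ^ (K + 1) ≤ 1 := by
      have h1 : t ^ (K + 1) ≤ t := by
        calc t ^ (K + 1) ≤ t ^ 1 := pow_le_pow_of_le_one ht0.le ht1 (by omega)
          _ = t := pow_one t
      have h2 : C * t ≤ 1 := by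
        rw [le_div_iff₀ (by positivity)] at htC; nlinarith
      nlinarith [mul_le_mul_of_nonneg_left h1 hC]
    have hua : |u t - a| ≤ 1 := hK.trans hCt
    have ha2 : |a| ≤ 2 := by
      have : |a| ≤ |u t| + |u t - a| := by
        calc |a| = |u t - (u t - a)| := by ring_nf
          _ ≤ |u t| + |u t - a| := abs_sub _ _
      rw [abs_of_nonneg hu0] at this; linarith
    have hu2 : |u t| ≤ 2 := by rw [abs_of_nonneg hu0]; linarith
    -- split the tail series at K+1
    have hs : Summable fun c => t ^ c * P N c (u t) := (heq t ⟨ht0, htt₀⟩).summable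
    have hs1 : Summable fun j => t ^ (j + 1) * P N (j + 1) (u t) :=
      (summable_nat_add_iff (f := fun c => t ^ c * P N c (u t)) 1).2 hs
    have hsplit : ∑ j ∈ Finset.range (K + 1), t ^ (j + 1) * P N (j + 1) (u t)
        + ∑' j, t ^ (j + (K + 1) + 1) * P N (j + (K + 1) + 1) (u t) = ∑' j, t ^ (j + 1) * P N (j + 1) (u t) :=
      hs1.sum_add_tsum_nat_add (K + 1)
    -- Σ_{j<K+1} g j + Σ' j, g (j+K+1) = Σ' g = 1 - u
    have hT := htail t ⟨ht0, htt₀⟩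
    have htailb : ∑' j, t ^ (j + (K + 1) + 1) * P N (j + (K + 1) + 1) (u t) ≤ 2 * B * (ρ * t) ^ (K + 2) := by
      have := tsum_tail_le N hB hρ ht0 hρt hN hu0 hu1 hs (K + 2)
      simpa [add_assoc] using this
    have htail0 : 0 ≤ ∑' j, t ^ (j + (K + 1) + 1) * P N (j + (K + 1) + 1) (u t) :=
      tsum_nonneg fun j => mul_nonneg (by positivity) (P_nonneg N hu0)
    -- the finite part: Lipschitz
    have hfin : |∑ j ∈ Finset.range (K + 1), t ^ (j + 1) * (P N (j + 1) a - P N (j + 1) (u t))|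
        ≤ t ^ (K + 2) * (C * Lsum) := by
      calc |∑ j ∈ Finset.range (K + 1), t ^ (j + 1) * (P N (j + 1) a - P N (j + 1) (u t))|
          ≤ ∑ j ∈ Finset.range (K + 1), |t ^ (j + 1) * (P N (j + 1) a - P N (j + 1) (u t))| := Finset.abs_sum_le_sum_abs _ _
        _ ≤ ∑ j ∈ Finset.range (K + 1), t * (L N (j + 1) * (C * t ^ (K + 1))) := by
            refine Finset.sum_le_sum fun j _ => ?_
            rw [abs_mul, abs_of_nonneg (by positivity)]
            have h1 : t ^ (j + 1) ≤ t := by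
              calc t ^ (j + 1) ≤ t ^ 1 := pow_le_pow_of_le_one ht0.le ht1 (by omega)
                _ = t := pow_one t
            have h2 : |P N (j + 1) a - P N (j + 1) (u t)| ≤ L N (j + 1) * (C * t ^ (K + 1)) := by
              refine (abs_P_sub_P_le N ha2 hu2).trans ?_
              rw [abs_sub_comm]
              exact mul_le_mul_of_nonneg_left hK (L_nonneg N _)
            exact mul_le_mul h1 h2 (abs_nonneg _) ht0.le
        _ = t ^ (K + 2) * (C * Lsum) := by rw [hLsum, Finset.mul_sum, Finset.mul_sum]; refine Finset.sum_congr rfl fun j _ => ?_; ring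
    -- assemble
    rw [ev_A_succ]
    have hdiff : u t - (1 - ∑ j ∈ Finset.range (K + 1), t ^ (j + 1) * P N (j + 1) a) =
        ∑ j ∈ Finset.range (K + 1), t ^ (j + 1) * (P N (j + 1) a - P N (j + 1) (u t))
          - ∑' j, t ^ (j + (K + 1) + 1) * P N (j + (K + 1) + 1) (u t) := by
      rw [Finset.sum_congr rfl fun j _ => mul_sub (t ^ (j + 1)) (P N (j + 1) a) (P N (j + 1) (u t)),
        Finset.sum_sub_distrib]
      linarith [hsplit, hT]
    rw [hdiff]
    calc |∑ j ∈ Finset.range (K + 1), t ^ (j + 1) * (P N (j + 1) a - P N (j + 1) (u t))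
          - ∑' j, t ^ (j + (K + 1) + 1) * P N (j + (K + 1) + 1) (u t)|
        ≤ |∑ j ∈ Finset.range (K + 1), t ^ (j + 1) * (P N (j + 1) a - P N (j + 1) (u t))|
          + |∑' j, t ^ (j + (K + 1) + 1) * P N (j + (K + 1) + 1) (u t)| := abs_sub _ _
      _ ≤ t ^ (K + 2) * (C * Lsum) + 2 * B * (ρ * t) ^ (K + 2) := by
          rw [abs_of_nonneg htail0]; exact add_le_add hfin htailb
      _ = (C * Lsum + 2 * B * ρ ^ (K + 2)) * t ^ (K + 1 + 1) := by rw [mul_pow]; ring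

end CostSeries

/-! ### The pulled walk: the expansion of `u(y) = y e^{-λ_B(y)}` and of `e^{λ_B(y)}` to all orders -/

/-- `c_1 = #(1-step SAWs)` as a real number (`= 4` on `ℤ²`; only `≥ 1` is used). [cite: MadrasSlade1993, §1.2] -/
def kappa : ℝ := (count 2 1 : ℝ)

/-- `κ ≥ 1`. [cite: MadrasSlade1993, §1.2] -/
private theorem one_le_kappa : 1 ≤ kappa := by
  unfold kappa; exact_mod_cast one_le_count 2 1

/-- The cost-class bound `Σ_{n < 2c+2} N_{c,n} ≤ 2κ · (2κ²)^c` (`κ = c_1`). [cite: MadrasSlade1993, §1.2] -/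
theorem sum_costCoeff_le (c : ℕ) :
    (∑ n ∈ Finset.range (2 * c + 2), (costCoeff c n : ℝ)) ≤ 2 * kappa * (2 * kappa ^ 2) ^ c := by
  have hκ := one_le_kappa
  have hκ0 : 0 ≤ kappa := by linarith
  have hterm : ∀ n ∈ Finset.range (2 * c + 2), (costCoeff c n : ℝ) ≤ kappa ^ (2 * c + 1) := by
    intro n hn
    have hn' : n ≤ 2 * c + 1 := by have := Finset.mem_range.1 hn; omega
    calc (costCoeff c n : ℝ) ≤ (count 2 n : ℝ) := by exact_mod_cast costCoeff_le_count c n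
      _ ≤ (count 2 1 : ℝ) ^ n := count_le_count_one_pow 1 n
      _ = kappa ^ n := rfl
      _ ≤ kappa ^ (2 * c + 1) := pow_le_pow_right₀ hκ hn'
  calc (∑ n ∈ Finset.range (2 * c + 2), (costCoeff c n : ℝ))
      ≤ ∑ _n ∈ Finset.range (2 * c + 2), kappa ^ (2 * c + 1) := Finset.sum_le_sum hterm
    _ = (2 * c + 2 : ℕ) * kappa ^ (2 * c + 1) := by rw [Finset.sum_const, Finset.card_range, nsmul_eq_mul]
    _ ≤ 2 ^ (c + 1) * kappa ^ (2 * c + 1) := by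
        refine mul_le_mul_of_nonneg_right ?_ (by positivity)
        have : ∀ m : ℕ, (2 * m + 2 : ℕ) ≤ 2 ^ (m + 1) := by
          intro m
          induction m with
          | zero => norm_num
          | succ k ih =>
            have h2 : 2 ^ 1 ≤ 2 ^ (k + 1) := Nat.pow_le_pow_right (by norm_num) (by omega)
            calc 2 * (k + 1) + 2 = (2 * k + 2) + 2 := by ring
              _ ≤ 2 ^ (k + 1) + 2 ^ (k + 1) := by omega
              _ = 2 ^ (k + 1 + 1) := by ring
        exact_mod_cast this c
    _ = 2 * kappa * (2 * kappa ^ 2) ^ c := by rw [mul_pow]; ring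

/-- `P_0(x) = x` for the pulled walk (`N_{0,0} = 0`, `N_{0,1} = 1`). [cite: MadrasSlade1993, §4.2, eq. (4.2.20)–(4.2.22) (p. 94, 2013 reprint)] -/
theorem P_costCoeff_zero (x : ℝ) : CostSeries.P costCoeff 0 x = x := by
  simp [CostSeries.P, costCoeff_zero]

/-- Kesten's equation in the variable `t = 1/y`: `Σ_c t^c P_c(u(1/t)) = 1` for `0 < t ≤ 1/18`. [cite: Beaton2015, Lemma 2] -/
theorem hasSum_costPoly_inv {t : ℝ} (ht : 0 < t) (ht18 : t ≤ 1 / 18) :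
    HasSum (fun c => t ^ c * CostSeries.P costCoeff c (largeForceU t⁻¹)) 1 := by
  have hy : 18 ≤ t⁻¹ := by rw [le_inv_comm₀ (by norm_num) ht]; simpa [one_div] using ht18
  have h := hasSum_costPoly_largeForce hy
  refine h.congr_fun fun c => ?_
  rw [CostSeries.P, inv_pow, div_inv_eq_mul, mul_comm]

/-- **The expansion of `u(y) = y e^{-λ_B(y)}` to all orders**: for every `K`, with the integer polynomial `A_K = CostSeries.A costCoeff K`,
`|u(y) − A_K(1/y)| ≤ C / y^{K+1}` for all large `y`. [cite: JansevanRensburgWhittington2013, §3.2 Theorem 8 (arXiv v4 p. 11)] -/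
theorem largeForceU_expansion (K : ℕ) :
    ∃ C y₁ : ℝ, 0 ≤ C ∧ 0 < y₁ ∧ ∀ y ≥ y₁, |largeForceU y - CostSeries.ev (CostSeries.A costCoeff K) y⁻¹| ≤ C / y ^ (K + 1) := by
  have hκ := one_le_kappa
  obtain ⟨C, t₁, hC, ht₁, ht₁₀, hb⟩ := CostSeries.expansion costCoeff (B := 2 * kappa) (ρ := 2 * kappa ^ 2) (t₀ := 1 / 18)
    (u := fun t => largeForceU t⁻¹) (by positivity) (by positivity) (by norm_num) sum_costCoeff_le P_costCoeff_zero
    (fun t ht => by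
      have hy : 18 ≤ t⁻¹ := by rw [le_inv_comm₀ (by norm_num) ht.1]; simpa [one_div] using ht.2
      exact ⟨(largeForceU_pos (by linarith)).le, (largeForceU_lt_one (by linarith)).le⟩)
    (fun t ht => hasSum_costPoly_inv ht.1 ht.2) K
  refine ⟨C, t₁⁻¹, hC, inv_pos.2 ht₁, fun y hy => ?_⟩
  have hy0 : 0 < y := lt_of_lt_of_le (inv_pos.2 ht₁) hy
  have ht : y⁻¹ ∈ Set.Ioc 0 t₁ := ⟨inv_pos.2 hy0, by rw [inv_le_comm₀ hy0 ht₁]; exact hy⟩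
  have := hb y⁻¹ ht
  rw [inv_inv, inv_pow, ← div_eq_mul_inv] at this
  exact this

/-- The integer polynomial `E_K := Σ_{j ≤ K} (1 − A_K)^j` — the truncated inverse of `A_K`; `e^{λ_B(y)} = y · E_K(1/y) + O(y^{-K})`.
[cite: JansevanRensburgWhittington2013, §3.2 Theorem 8 (arXiv v4 p. 11)] -/
def largeForcePoly (K : ℕ) : Polynomial ℤ :=
  ∑ j ∈ Finset.range (K + 1), (1 - CostSeries.A costCoeff K) ^ j

/-- Evaluation of `E_K`. [folklore] -/
private theorem ev_largeForcePoly (K : ℕ) (t : ℝ) :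
    CostSeries.ev (largeForcePoly K) t = ∑ j ∈ Finset.range (K + 1), (1 - CostSeries.ev (CostSeries.A costCoeff K) t) ^ j := by
  simp [CostSeries.ev, largeForcePoly, map_sum]

/-- `u(y) ≥ 1/2` for `y ≥ 9`. [cite: JansevanRensburgWhittington2013, §3.2 Theorem 8 (arXiv v4 p. 11)] -/
theorem half_le_largeForceU {y : ℝ} (hy : 9 ≤ y) : 1 / 2 ≤ largeForceU y := by
  have h := (largeForceU_mem_Icc hy).1
  have hy0 : 0 < y := by linarith
  have hden : 0 < y + 2 - 2 / y + 6 / y ^ 2 - 20 / y ^ 3 + 300 / y ^ 4 := by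
    have h2 : 2 / y ≤ 2 / 9 := div_le_div_of_nonneg_left (by norm_num) (by norm_num) hy
    have h3 : 20 / y ^ 3 ≤ 20 / 9 ^ 3 :=
      div_le_div_of_nonneg_left (by norm_num) (by norm_num) (pow_le_pow_left₀ (by norm_num) hy 3)
    have h4 : 0 ≤ 6 / y ^ 2 := by positivity
    have h5 : 0 ≤ 300 / y ^ 4 := by positivity
    linarith
  refine le_trans ?_ h
  rw [div_le_div_iff₀ (by norm_num) hden]
  have h2 : 6 / y ^ 2 ≤ 6 / 9 ^ 2 :=
    div_le_div_of_nonneg_left (by norm_num) (by norm_num) (pow_le_pow_left₀ (by norm_num) hy 2)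
  have h3 : 300 / y ^ 4 ≤ 300 / 9 ^ 4 :=
    div_le_div_of_nonneg_left (by norm_num) (by norm_num) (pow_le_pow_left₀ (by norm_num) hy 4)
  have h4 : 0 ≤ 2 / y := by positivity
  have h5 : 0 ≤ 20 / y ^ 3 := by positivity
  nlinarith

/-- `1 − u(y) ≤ 3/y` for `y ≥ 9`. [cite: JansevanRensburgWhittington2013, §3.2 Theorem 8 (arXiv v4 p. 11)] -/
theorem one_sub_largeForceU_le {y : ℝ} (hy : 9 ≤ y) : 1 - largeForceU y ≤ 3 / y := by
  have h := (largeForceU_mem_Icc hy).1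
  have hy0 : 0 < y := by linarith
  set D := y + 2 - 2 / y + 6 / y ^ 2 - 20 / y ^ 3 + 300 / y ^ 4 with hD
  have h2 : 6 / y ^ 2 ≤ 6 / 9 ^ 2 :=
    div_le_div_of_nonneg_left (by norm_num) (by norm_num) (pow_le_pow_left₀ (by norm_num) hy 2)
  have h3 : 300 / y ^ 4 ≤ 300 / 9 ^ 4 :=
    div_le_div_of_nonneg_left (by norm_num) (by norm_num) (pow_le_pow_left₀ (by norm_num) hy 4)
  have h4 : 0 ≤ 2 / y := by positivity
  have h5 : 0 ≤ 20 / y ^ 3 := by positivity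
  have h6 : 2 / y ≤ 2 / 9 := div_le_div_of_nonneg_left (by norm_num) (by norm_num) hy
  have h7 : 20 / y ^ 3 ≤ 20 / 9 ^ 3 :=
    div_le_div_of_nonneg_left (by norm_num) (by norm_num) (pow_le_pow_left₀ (by norm_num) hy 3)
  have h8 : 0 ≤ 6 / y ^ 2 := by positivity
  have h9 : 0 ≤ 300 / y ^ 4 := by positivity
  have hDy : y ≤ D := by rw [hD]; linarith
  have hD3 : D ≤ y + 3 := by rw [hD]; linarith
  have hD0 : 0 < D := by linarith
  -- 1 - y/D = (D - y)/D ≤ 3/D ≤ 3/y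
  have : 1 - y / D ≤ 3 / y := by
    rw [show 1 - y / D = (D - y) / D by field_simp]
    calc (D - y) / D ≤ 3 / D := div_le_div_of_nonneg_right (by linarith) hD0.le
      _ ≤ 3 / y := div_le_div_of_nonneg_left (by norm_num) hy0 hDy
  linarith

/-- ★★ **THE LARGE-FORCE EXPANSION OF `e^{λ_B(y)}` EXISTS TO ALL ORDERS AND HAS INTEGER COEFFICIENTS**: for every `K` there are
`C, y₁` with `|e^{λ_B(y)} − y · E_K(1/y)| ≤ C / y^K` for all `y ≥ y₁`, where `E_K = largeForcePoly K ∈ ℤ[X]` is the explicit integer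
polynomial built from the irreducible-bridge cost counts `N_{c,n}` (`A_0 = 1`, `A_{K+1} = 1 − Σ_{c=1}^{K+1} X^c P_c(A_K)`,
`E_K = Σ_{j ≤ K} (1 − A_K)^j`). Since an asymptotic expansion is unique, the expansion coefficients of `e^{λ_B(y)}` in powers of
`1/y` are the (integer) coefficients of the `E_K`; print has the first order `e^{λ(y)} = y + O(1)` only.
[cite: JansevanRensburgWhittington2013, §3.2 Theorem 8 (arXiv v4 p. 11)] [cite: Beaton2015, Lemma 2] -/
theorem exp_pulledBridgeFreeEnergy_expansion (K : ℕ) :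
    ∃ C y₁ : ℝ, 0 < y₁ ∧ ∀ y ≥ y₁,
      |Real.exp (pulledBridgeFreeEnergy 2 y) - y * CostSeries.ev (largeForcePoly K) y⁻¹| ≤ C / y ^ K := by
  obtain ⟨C, y₁, hC, hy₁, hb⟩ := largeForceU_expansion K
  -- thresholds: y ≥ y₁, y ≥ 9, y ≥ 1, and C / y^{K+1} ≤ 1/4 (via y ≥ 4C + 1)
  refine ⟨8 * C + 4 * (3 + C) ^ (K + 1), max y₁ (max 9 (4 * C + 1)), lt_max_of_lt_left hy₁, fun y hy => ?_⟩
  have hyy₁ : y₁ ≤ y := le_trans (le_max_left _ _) hy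
  have hy9 : 9 ≤ y := le_trans ((le_max_left _ _).trans (le_max_right _ _)) hy
  have hyC : 4 * C + 1 ≤ y := le_trans ((le_max_right _ _).trans (le_max_right _ _)) hy
  have hy0 : 0 < y := by linarith
  have hy1 : 1 ≤ y := by linarith
  set u := largeForceU y with hu
  set a := CostSeries.ev (CostSeries.A costCoeff K) y⁻¹ with ha
  have hK : |u - a| ≤ C / y ^ (K + 1) := hb y hyy₁
  have hu2 : 1 / 2 ≤ u := half_le_largeForceU hy9
  have hu1 : u ≤ 1 := (largeForceU_lt_one hy9).le
  -- C / y^{K+1} ≤ C / y ≤ 1/4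
  have hpow : y ≤ y ^ (K + 1) := by
    calc y = y ^ 1 := (pow_one y).symm
      _ ≤ y ^ (K + 1) := pow_le_pow_right₀ hy1 (by omega)
  have hCy : C / y ^ (K + 1) ≤ C / y := div_le_div_of_nonneg_left hC hy0 hpow
  have hCy4 : C / y ≤ 1 / 4 := by rw [div_le_div_iff₀ hy0 (by norm_num)]; linarith
  have hua : |u - a| ≤ 1 / 4 := hK.trans (hCy.trans hCy4)
  have ha4 : 1 / 4 ≤ a := by have := abs_le.1 hua; linarith
  have ha0 : 0 < a := by linarith
  have hu0 : 0 < u := by linarith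
  -- (1) |1/u - 1/a| ≤ 8 |u - a|
  have h1 : |u⁻¹ - a⁻¹| ≤ 8 * (C / y ^ (K + 1)) := by
    rw [inv_sub_inv hu0.ne' ha0.ne', abs_div, abs_mul, abs_of_pos hu0, abs_of_pos ha0, abs_sub_comm]
    rw [div_le_iff₀ (mul_pos hu0 ha0)]
    calc |u - a| ≤ C / y ^ (K + 1) := hK
      _ = 8 * (C / y ^ (K + 1)) * (1 / 2 * (1 / 4)) := by ring
      _ ≤ 8 * (C / y ^ (K + 1)) * (u * a) := by
          refine mul_le_mul_of_nonneg_left (mul_le_mul hu2 ha4 (by norm_num) hu0.le) (by positivity)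
  -- (2) 1/a - E_K(1/y) = (1-a)^{K+1}/a with |1 - a| ≤ (3 + C)/y
  have hE : CostSeries.ev (largeForcePoly K) y⁻¹ = ∑ j ∈ Finset.range (K + 1), (1 - a) ^ j := ev_largeForcePoly K y⁻¹
  have hgeom : a * ∑ j ∈ Finset.range (K + 1), (1 - a) ^ j = 1 - (1 - a) ^ (K + 1) := by
    have := mul_neg_geom_sum (1 - a) (K + 1)
    rw [sub_sub_cancel] at this
    exact this
  have h1a : |1 - a| ≤ (3 + C) / y := by
    calc |1 - a| = |(1 - u) + (u - a)| := by ring_nf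
      _ ≤ |1 - u| + |u - a| := abs_add_le _ _
      _ ≤ 3 / y + C / y := by
          refine add_le_add ?_ (hK.trans hCy)
          rw [abs_of_nonneg (by linarith)]; exact one_sub_largeForceU_le hy9
      _ = (3 + C) / y := by ring
  have h2 : |a⁻¹ - CostSeries.ev (largeForcePoly K) y⁻¹| ≤ 4 * ((3 + C) / y) ^ (K + 1) := by
    have heq : a⁻¹ - CostSeries.ev (largeForcePoly K) y⁻¹ = (1 - a) ^ (K + 1) / a := by
      rw [hE, eq_div_iff ha0.ne', sub_mul, inv_mul_cancel₀ ha0.ne', mul_comm, hgeom]; ring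
    rw [heq, abs_div, abs_of_pos ha0, abs_pow, div_le_iff₀ ha0]
    calc |1 - a| ^ (K + 1) ≤ ((3 + C) / y) ^ (K + 1) := pow_le_pow_left₀ (abs_nonneg _) h1a _
      _ = 4 * ((3 + C) / y) ^ (K + 1) * (1 / 4) := by ring
      _ ≤ 4 * ((3 + C) / y) ^ (K + 1) * a := mul_le_mul_of_nonneg_left ha4 (by positivity)
  -- assemble: e^{λ_B} = y/u
  rw [exp_pulledBridgeFreeEnergy_eq_div hy0, ← hu, div_eq_mul_inv, ← mul_sub, abs_mul, abs_of_pos hy0]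
  have hsum : |u⁻¹ - CostSeries.ev (largeForcePoly K) y⁻¹| ≤ 8 * (C / y ^ (K + 1)) + 4 * ((3 + C) / y) ^ (K + 1) := by
    calc |u⁻¹ - CostSeries.ev (largeForcePoly K) y⁻¹| = |(u⁻¹ - a⁻¹) + (a⁻¹ - CostSeries.ev (largeForcePoly K) y⁻¹)| := by ring_nf
      _ ≤ |u⁻¹ - a⁻¹| + |a⁻¹ - CostSeries.ev (largeForcePoly K) y⁻¹| := abs_add_le _ _
      _ ≤ _ := add_le_add h1 h2
  calc y * |u⁻¹ - CostSeries.ev (largeForcePoly K) y⁻¹| ≤ y * (8 * (C / y ^ (K + 1)) + 4 * ((3 + C) / y) ^ (K + 1)) :=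
        mul_le_mul_of_nonneg_left hsum hy0.le
    _ = (8 * C + 4 * (3 + C) ^ (K + 1)) / y ^ K := by
        rw [div_pow, pow_succ]
        field_simp

/-- The approximants have constant term `1`: `A_K(0) = 1`. [folklore] -/
private theorem eval_A_zero (N : ℕ → ℕ → ℕ) : ∀ K, (CostSeries.A N K).eval 0 = 1
  | 0 => by simp [CostSeries.A]
  | K + 1 => by
    simp [CostSeries.A, Polynomial.eval_finsetSum]

/-- **The leading term is `y`**: `E_K(0) = 1` for every `K`, i.e. `e^{λ_B(y)} = y · (1 + O(1/y))` — the constant coefficient of every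
`largeForcePoly K` is `1`. [cite: JansevanRensburgWhittington2013, §3.2 Theorem 8 (arXiv v4 p. 11)] -/
theorem largeForcePoly_coeff_zero (K : ℕ) : (largeForcePoly K).coeff 0 = 1 := by
  rw [Polynomial.coeff_zero_eq_eval_zero, largeForcePoly, Polynomial.eval_finsetSum]
  simp [eval_A_zero, Finset.sum_range_succ']

/-! ### Uniqueness: the canonical integer coefficients -/

/-- A real polynomial which is `O(t^m)` at `0⁺` has no coefficient below degree `m`. [folklore] -/
private theorem coeff_eq_zero_of_abs_le :
    ∀ (m : ℕ) (p : Polynomial ℝ) (C t₁ : ℝ), 0 < t₁ → (∀ t ∈ Set.Ioc 0 t₁, |p.eval t| ≤ C * t ^ m) →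
      ∀ j < m, p.coeff j = 0
  | 0, _, _, _, _, _, j, hj => absurd hj (Nat.not_lt_zero j)
  | m + 1, p, C, t₁, ht₁, h, j, hj => by
    -- the constant coefficient vanishes: p(t) → p(0) as t → 0⁺ while |p(t)| ≤ C t^{m+1} → 0
    have h0 : p.coeff 0 = 0 := by
      rw [Polynomial.coeff_zero_eq_eval_zero]
      by_contra hne
      have hlim : Tendsto (fun t : ℝ => p.eval t) (𝓝[>] 0) (𝓝 (p.eval 0)) :=
        (p.continuous.tendsto 0).mono_left nhdsWithin_le_nhds
      have hbd : Tendsto (fun t : ℝ => C * t ^ (m + 1)) (𝓝[>] 0) (𝓝 0) := by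
        have : Tendsto (fun t : ℝ => C * t ^ (m + 1)) (𝓝 0) (𝓝 (C * 0 ^ (m + 1))) :=
          tendsto_const_nhds.mul ((continuous_pow (m + 1)).tendsto 0)
        rw [zero_pow (Nat.succ_ne_zero m), mul_zero] at this
        exact this.mono_left nhdsWithin_le_nhds
      have habs : Tendsto (fun t : ℝ => |p.eval t|) (𝓝[>] 0) (𝓝 |p.eval 0|) := hlim.abs
      have hle : |p.eval 0| ≤ 0 := by
        refine le_of_tendsto_of_tendsto habs hbd ?_
        filter_upwards [Ioc_mem_nhdsGT ht₁] with t ht using h t ht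
      exact hne (abs_nonpos_iff.1 hle)
    -- factor `p = X * q` and apply the induction hypothesis to `q`
    obtain ⟨q, hq⟩ : Polynomial.X ∣ p := Polynomial.X_dvd_iff.2 h0
    have hqb : ∀ t ∈ Set.Ioc 0 t₁, |q.eval t| ≤ C * t ^ m := by
      intro t ht
      have ht0 : 0 < t := ht.1
      have := h t ht
      rw [hq, Polynomial.eval_mul, Polynomial.eval_X, abs_mul, abs_of_pos ht0, pow_succ] at this
      nlinarith [abs_nonneg (q.eval t), pow_pos ht0 m]
    rcases j with _ | j
    · exact h0
    · have := coeff_eq_zero_of_abs_le m q C t₁ ht₁ hqb j (by omega)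
      rw [hq, Polynomial.coeff_X_mul]
      exact this

/-- `ev p t` is the evaluation of the real image of `p`. [folklore] -/
private theorem ev_eq_eval_map (p : Polynomial ℤ) (t : ℝ) : CostSeries.ev p t = (p.map (Int.castRingHom ℝ)).eval t := by
  rw [CostSeries.ev, Polynomial.aeval_def, Polynomial.eval_map, algebraMap_int_eq]

/-- THE EXPANSION COEFFICIENTS: `c_k := [X^k] E_k` (so that `e^{λ_B(y)} ~ Σ_k c_k y^{1−k}`; `c_0 = 1`).
[cite: JansevanRensburgWhittington2013, §3.2 Theorem 8 (arXiv v4 p. 11)] -/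
def largeForceCoeff (k : ℕ) : ℤ := (largeForcePoly k).coeff k

/-- **Coefficient stability** (uniqueness of the asymptotic expansion): `[X^k] E_K = [X^k] E_{K'}` for `k ≤ K ≤ K'`.
[cite: JansevanRensburgWhittington2013, §3.2 Theorem 8 (arXiv v4 p. 11)] -/
theorem largeForcePoly_coeff_eq {k K K' : ℕ} (hk : k ≤ K) (hK : K ≤ K') :
    (largeForcePoly K).coeff k = (largeForcePoly K').coeff k := by
  obtain ⟨C, y₁, hy₁, hb⟩ := exp_pulledBridgeFreeEnergy_expansion K
  obtain ⟨C', y₁', hy₁', hb'⟩ := exp_pulledBridgeFreeEnergy_expansion K'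
  -- r := E_K − E_K' over ℝ satisfies |r(t)| ≤ (|C| + |C'|) t^{K+1} on (0, t₁]
  set r : Polynomial ℝ := (largeForcePoly K - largeForcePoly K').map (Int.castRingHom ℝ) with hr
  set Y := max (max y₁ y₁') 1 with hY
  have hY0 : 0 < Y := lt_of_lt_of_le one_pos (le_max_right _ _)
  have hev : ∀ (p : Polynomial ℤ) (t : ℝ), (p.map (Int.castRingHom ℝ)).eval t = CostSeries.ev p t :=
    fun p t => (ev_eq_eval_map p t).symm
  have hbound : ∀ t ∈ Set.Ioc 0 Y⁻¹, |r.eval t| ≤ (|C| + |C'|) * t ^ (K + 1) := by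
    intro t ht
    obtain ⟨y, rfl⟩ : ∃ y : ℝ, t = y⁻¹ := ⟨t⁻¹, (inv_inv t).symm⟩
    have ht0 : 0 < y⁻¹ := ht.1
    have hy0 : 0 < y := inv_pos.1 ht0
    have hyY : Y ≤ y := by
      have := ht.2
      rwa [inv_le_inv₀ hy0 hY0] at this
    have hy1 : 1 ≤ y := le_trans (le_max_right _ _) hyY
    have hyy₁ : y₁ ≤ y := le_trans ((le_max_left _ _).trans (le_max_left _ _)) hyY
    have hyy₁' : y₁' ≤ y := le_trans ((le_max_right _ _).trans (le_max_left _ _)) hyY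
    have h1 := hb y hyy₁
    have h2 := hb' y hyy₁'
    have hr_eval : r.eval y⁻¹ = CostSeries.ev (largeForcePoly K) y⁻¹ - CostSeries.ev (largeForcePoly K') y⁻¹ := by
      rw [hr, Polynomial.map_sub, Polynomial.eval_sub, hev, hev]
    -- |y E_K − y E_K'| ≤ C/y^K + C'/y^K' ≤ (|C| + |C'|)/y^K
    have hdiff : |y * CostSeries.ev (largeForcePoly K) y⁻¹ - y * CostSeries.ev (largeForcePoly K') y⁻¹| ≤ (|C| + |C'|) / y ^ K := by
      have hpow : y ^ K ≤ y ^ K' := pow_le_pow_right₀ hy1 hK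
      have hCK : C / y ^ K ≤ |C| / y ^ K := div_le_div_of_nonneg_right (le_abs_self C) (by positivity)
      have hCK' : C' / y ^ K' ≤ |C'| / y ^ K := by
        calc C' / y ^ K' ≤ |C'| / y ^ K' := div_le_div_of_nonneg_right (le_abs_self C') (by positivity)
          _ ≤ |C'| / y ^ K := div_le_div_of_nonneg_left (abs_nonneg _) (by positivity) hpow
      calc |y * CostSeries.ev (largeForcePoly K) y⁻¹ - y * CostSeries.ev (largeForcePoly K') y⁻¹|
          = |(Real.exp (pulledBridgeFreeEnergy 2 y) - y * CostSeries.ev (largeForcePoly K') y⁻¹)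
              - (Real.exp (pulledBridgeFreeEnergy 2 y) - y * CostSeries.ev (largeForcePoly K) y⁻¹)| := by ring_nf
        _ ≤ |Real.exp (pulledBridgeFreeEnergy 2 y) - y * CostSeries.ev (largeForcePoly K') y⁻¹|
              + |Real.exp (pulledBridgeFreeEnergy 2 y) - y * CostSeries.ev (largeForcePoly K) y⁻¹| := abs_sub _ _
        _ ≤ C' / y ^ K' + C / y ^ K := add_le_add h2 h1
        _ ≤ (|C| + |C'|) / y ^ K := by rw [add_div]; linarith
    -- divide by y: |r(t)| ≤ (|C|+|C'|)/y^{K+1} = (|C|+|C'|) t^{K+1}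
    have : |r.eval y⁻¹| = |y * CostSeries.ev (largeForcePoly K) y⁻¹ - y * CostSeries.ev (largeForcePoly K') y⁻¹| / y := by
      rw [hr_eval, ← mul_sub, abs_mul, abs_of_pos hy0, mul_div_cancel_left₀ _ hy0.ne']
    rw [this, div_le_iff₀ hy0]
    calc |y * CostSeries.ev (largeForcePoly K) y⁻¹ - y * CostSeries.ev (largeForcePoly K') y⁻¹|
        ≤ (|C| + |C'|) / y ^ K := hdiff
      _ = (|C| + |C'|) * y⁻¹ ^ (K + 1) * y := by
          rw [inv_pow, pow_succ]; field_simp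
  have hz := coeff_eq_zero_of_abs_le (K + 1) r (|C| + |C'|) Y⁻¹ (inv_pos.2 hY0) hbound k (by omega)
  rw [hr, Polynomial.coeff_map, Polynomial.coeff_sub, map_sub, sub_eq_zero, eq_intCast, eq_intCast] at hz
  exact_mod_cast hz

/-- `[X^k] E_K = c_k` for every `k ≤ K`. [cite: JansevanRensburgWhittington2013, §3.2 Theorem 8 (arXiv v4 p. 11)] -/
theorem largeForcePoly_coeff {k K : ℕ} (hk : k ≤ K) : (largeForcePoly K).coeff k = largeForceCoeff k :=
  (largeForcePoly_coeff_eq le_rfl hk).symm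

/-- `c_0 = 1`. [cite: JansevanRensburgWhittington2013, §3.2 Theorem 8 (arXiv v4 p. 11)] -/
theorem largeForceCoeff_zero : largeForceCoeff 0 = 1 := largeForcePoly_coeff_zero 0

/-- A real polynomial is bounded by the sum of the absolute values of its coefficients on `[0, 1]`. [folklore] -/
private theorem abs_eval_le_sum_abs_coeff (w : Polynomial ℝ) {t : ℝ} (ht0 : 0 ≤ t) (ht1 : t ≤ 1) :
    |w.eval t| ≤ ∑ i ∈ Finset.range (w.natDegree + 1), |w.coeff i| := by
  rw [Polynomial.eval_eq_sum_range]
  refine (Finset.abs_sum_le_sum_abs _ _).trans (Finset.sum_le_sum fun i _ => ?_)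
  rw [abs_mul, abs_pow, abs_of_nonneg ht0]
  exact mul_le_of_le_one_right (abs_nonneg _) (pow_le_one₀ ht0 ht1)

/-- ★★ **The large-force expansion in CLASSICAL FORM**: with THE integer coefficients `c_k = largeForceCoeff k` (one sequence for all
orders), for every `K` there are `C, y₁` with `|e^{λ_B(y)} − Σ_{k ≤ K} c_k y^{1−k}| ≤ C / y^K` for all `y ≥ y₁`; `c_0 = 1`.
[cite: JansevanRensburgWhittington2013, §3.2 Theorem 8 (arXiv v4 p. 11)] [cite: Beaton2015, Lemma 2] -/
theorem exp_pulledBridgeFreeEnergy_expansion_coeff (K : ℕ) :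
    ∃ C y₁ : ℝ, 0 < y₁ ∧ ∀ y ≥ y₁,
      |Real.exp (pulledBridgeFreeEnergy 2 y) - y * ∑ k ∈ Finset.range (K + 1), (largeForceCoeff k : ℝ) * y⁻¹ ^ k| ≤ C / y ^ K := by
  obtain ⟨C, y₁, hy₁, hb⟩ := exp_pulledBridgeFreeEnergy_expansion K
  -- E_K − Σ_{k ≤ K} c_k X^k is divisible by X^{K+1}
  set q : Polynomial ℤ := largeForcePoly K - ∑ k ∈ Finset.range (K + 1), Polynomial.C (largeForceCoeff k) * Polynomial.X ^ k with hq
  have hdvd : Polynomial.X ^ (K + 1) ∣ q := by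
    rw [Polynomial.X_pow_dvd_iff]
    intro d hd
    rw [hq, Polynomial.coeff_sub, Polynomial.finsetSum_coeff, largeForcePoly_coeff (by omega : d ≤ K)]
    simp only [Polynomial.coeff_C_mul, Polynomial.coeff_X_pow, mul_ite, mul_one, mul_zero]
    rw [Finset.sum_ite_eq (Finset.range (K + 1)) d, if_pos (Finset.mem_range.2 hd), sub_self]
  obtain ⟨w, hw⟩ := hdvd
  set wR : Polynomial ℝ := w.map (Int.castRingHom ℝ) with hwR
  set M : ℝ := ∑ i ∈ Finset.range (wR.natDegree + 1), |wR.coeff i| with hM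
  refine ⟨C + M, max y₁ 1, lt_max_of_lt_left hy₁, fun y hy => ?_⟩
  have hyy₁ : y₁ ≤ y := le_trans (le_max_left _ _) hy
  have hy1 : 1 ≤ y := le_trans (le_max_right _ _) hy
  have hy0 : 0 < y := by linarith
  have ht0 : 0 ≤ y⁻¹ := by positivity
  have ht1 : y⁻¹ ≤ 1 := inv_le_one_of_one_le₀ hy1
  -- E_K(t) = Σ_k c_k t^k + t^{K+1} w(t)
  have hsplit : CostSeries.ev (largeForcePoly K) y⁻¹ =
      ∑ k ∈ Finset.range (K + 1), (largeForceCoeff k : ℝ) * y⁻¹ ^ k + y⁻¹ ^ (K + 1) * wR.eval y⁻¹ := by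
    have h1 : largeForcePoly K = ∑ k ∈ Finset.range (K + 1), Polynomial.C (largeForceCoeff k) * Polynomial.X ^ k
        + Polynomial.X ^ (K + 1) * w := by rw [← hw, hq]; ring
    rw [hwR, ← ev_eq_eval_map, h1]
    simp only [CostSeries.ev, map_add, map_sum, map_mul, map_pow, Polynomial.aeval_X, eq_intCast, map_intCast]
  have hM0 : |wR.eval y⁻¹| ≤ M := abs_eval_le_sum_abs_coeff wR ht0 ht1
  have hmain := hb y hyy₁
  have heq : Real.exp (pulledBridgeFreeEnergy 2 y) - y * ∑ k ∈ Finset.range (K + 1), (largeForceCoeff k : ℝ) * y⁻¹ ^ k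
      = (Real.exp (pulledBridgeFreeEnergy 2 y) - y * CostSeries.ev (largeForcePoly K) y⁻¹)
        + y * (y⁻¹ ^ (K + 1) * wR.eval y⁻¹) := by rw [hsplit]; ring
  rw [heq]
  have htail : |y * (y⁻¹ ^ (K + 1) * wR.eval y⁻¹)| ≤ M / y ^ K := by
    rw [abs_mul, abs_of_pos hy0, abs_mul, abs_of_nonneg (by positivity), inv_pow]
    calc y * ((y ^ (K + 1))⁻¹ * |wR.eval y⁻¹|) = |wR.eval y⁻¹| / y ^ K := by
          rw [pow_succ]; field_simp
      _ ≤ M / y ^ K := div_le_div_of_nonneg_right hM0 (by positivity)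
  calc |Real.exp (pulledBridgeFreeEnergy 2 y) - y * CostSeries.ev (largeForcePoly K) y⁻¹ + y * (y⁻¹ ^ (K + 1) * wR.eval y⁻¹)|
      ≤ |Real.exp (pulledBridgeFreeEnergy 2 y) - y * CostSeries.ev (largeForcePoly K) y⁻¹| + |y * (y⁻¹ ^ (K + 1) * wR.eval y⁻¹)| :=
        abs_add_le _ _
    _ ≤ C / y ^ K + M / y ^ K := add_le_add hmain htail
    _ = (C + M) / y ^ K := by ring

end Literature.Probability.RandomPlanarGeometry.SAW.Zd
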